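import Summits.QuantumFields.BalabanUV.T4Continuum.Support.NE7PairColourStep
import Summits.QuantumFields.BalabanUV.T4Continuum.Support.NE7PairProfiles
import HarnessLib

/-!
# NE7PairColourGlue — THE GLUING INDUCTION OVER THE `2^d` PARITIES (F321): from a pinned `N`-equivariant pair-chart family (cube letter `η_ch`, site-closeness
# `τ_cc`), a core profile and parity-block maps, a GLOBAL unitary site gauge `u`, pinned at every block corner, `2NM`-periodic, within `4^{2^d}·τ_cc` of every chart at
# every site of its cube, and with pair defect `‖U_s(b)⁻¹(U′^{u})(b) − 1‖ ≤ 6^{2^d}·(7η_ch + 16·4^{2^d}τ_cc∕M)` on EVERY bond — provided `4^{2^d}·τ_cc ≤ 1∕4`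

Cell `pub-balaban`, sub-cell t4, lineage `b2b-balaban-t4-ne7-p1` (CRUX PROVER NE7 #1 = OWNER of row NE7), gen 94; memo
`t4/b2b-balaban-t4-ne7-p1-g94/PAIR-REP-ROAD.md` §6.  File 7 of the road to the PAIR RESIDUAL SUP-REPRESENTATIVE: `2^d` applications of F320 `NE7PairColourStep.colour_step`
(induction on a finite set of parities `Fin d → Fin 2`, base = the trivial gauge), then the tiling of `ℤ^d` by the cores (F319 `NE7PairProfiles.coreIndex_mem`) to see that
every site is covered at the end.  Bounds: `τ_s = (4^s − 1)τ_cc∕3`, `η_s = (6^s − 1)B∕5`, `B = 7η_ch + 16τ_{2^d}∕M`.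
WHAT ([folklore]; 0 def, 0 sorry; any C⋆-algebra, any `d`, `M ≥ 2`): `colour_glue`.
HONEST FRAMING: bookkeeping over F320; all geometric objects are hypotheses (F317–F319b supply them for d = 4); nothing of Bałaban's asserted; hleaves NOT discharged;
NE7 NOT PROVED; spine 0∕9; finite T⁴ rung (B)+1 — NOT infinite volume, NOT mass gap, NOT `BetaPertH`, NOT Clay.  Axioms ⊆ {propext, Classical.choice, Quot.sound}.
-/

set_option autoImplicit false

open NormedSpace
open scoped BigOperators

namespace Summit.QuantumFields.BalabanUV.T4Continuum.NE7PairColourGlue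

open Literature.MathematicalPhysics.QuantumFieldTheory.Balaban1983to89
open MatrixLog B7Prop1Explicit B7Prop2Explicit UnitaryRootInterpolation UnitaryGeodesic NE7PairGlueStep NE7PairColourStep
open NE7PairProfiles (coreIndex_mem)

noncomputable section

variable {𝔸 : Type*} [CStarAlgebra 𝔸] [Nontrivial 𝔸] {d : ℕ}

/-- The bound sequences are monotone∕compatible with the step: `4·(4^s − 1)∕3·τ + τ = (4^{s+1} − 1)∕3·τ`. [folklore] -/
theorem tau_step (s : ℕ) (τ : ℝ) : 4 * ((4 ^ s - 1) / 3 * τ) + τ = (4 ^ (s + 1) - 1) / 3 * τ := by rw [pow_succ]; ring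

/-- `(4^s − 1)∕3·τ ≤ (4^K − 1)∕3·τ` for `s ≤ K`, `τ ≥ 0`. [folklore] -/
theorem tau_mono {s K : ℕ} (h : s ≤ K) {τ : ℝ} (hτ : 0 ≤ τ) : (4 ^ s - 1) / 3 * τ ≤ (4 ^ K - 1) / 3 * τ := by
  have : (4 : ℝ) ^ s ≤ 4 ^ K := pow_le_pow_right₀ (by norm_num) h
  exact mul_le_mul_of_nonneg_right (by linarith) hτ

/-- The `η`-step: `7η_ch + 6·(6^s − 1)∕5·B + 16τ_s∕M ≤ (6^{s+1} − 1)∕5·B` when `7η_ch + 16τ_s∕M ≤ B`, `B ≥ 0`. [folklore] -/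
theorem eta_step (s : ℕ) {ηch τs M B : ℝ} (hB : 7 * ηch + 16 * τs / M ≤ B) :
    7 * ηch + 6 * ((6 ^ s - 1) / 5 * B) + 16 * τs / M ≤ (6 ^ (s + 1) - 1) / 5 * B := by
  rw [pow_succ]; nlinarith

/-- Every integer vector is a parity vector with entries in `{0,1}` plus twice a vector. [folklore] -/
theorem exists_parity_decomp (ζ : Site d) :
    ∃ (c : Fin d → Fin 2) (w : Site d), ζ = (fun i => ((c i : ℕ) : ℤ)) + (2 : ℤ) • w := by
  refine ⟨fun i => if ζ i % 2 = 0 then 0 else 1, fun i => ζ i / 2, ?_⟩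
  funext i
  simp only [Pi.add_apply, Pi.smul_apply, smul_eq_mul]
  have h := Int.emod_add_mul_ediv (ζ i) 2
  rcases Int.emod_two_eq_zero_or_one (ζ i) with h0 | h1
  · simp only [h0, if_true, Fin.val_zero, Nat.cast_zero]; omega
  · have : ¬ ζ i % 2 = 0 := by omega
    simp only [this, if_false, Fin.val_one, Nat.cast_one]; omega

/-- **THE GLUING INDUCTION OVER THE PARITIES** (see the file header). [folklore] -/
theorem colour_glue {Us U' : Site d → Fin d → 𝔸ˣ} (hUs : ∀ x μ, Us x μ ∈ unitaryUnits 𝔸) (hU' : ∀ x μ, U' x μ ∈ unitaryUnits 𝔸)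
    {M N : ℕ} (hM : 2 ≤ M)
    {g : Site d → Site d → 𝔸ˣ} (hgU : ∀ ζ x, g ζ x ∈ unitaryUnits 𝔸) (hpin : ∀ ζ, g ζ ((M : ℤ) • ζ) = 1) {ηch : ℝ} (hηch : 0 ≤ ηch)
    (herr : ∀ (ζ y : Site d) (κ : Fin d), (∀ i, |y i - (M : ℤ) * ζ i| ≤ (M : ℤ)) →
      ‖(((Us y κ)⁻¹ * gaugeAct (g ζ) U' y κ : 𝔸ˣ) : 𝔸) - 1‖ ≤ ηch)
    (hgeq : ∀ (ζ x : Site d) (i : Fin d), g (ζ + (N : ℤ) • e i) (x + ((N * M : ℕ) : ℤ) • e i) = g ζ x)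
    {τcc : ℝ} (hτcc0 : 0 ≤ τcc)
    (hτcc : ∀ (ζ ζ' x : Site d), (∀ i, |x i - (M : ℤ) * ζ i| ≤ (M : ℤ)) → (∀ i, |x i - (M : ℤ) * ζ' i| ≤ (M : ℤ)) →
      ‖((g ζ x : 𝔸ˣ) : 𝔸) - ((g ζ' x : 𝔸ˣ) : 𝔸)‖ ≤ τcc)
    (hsmall : (4 ^ (2 ^ d) - 1) / 3 * τcc ≤ 1 / 4)
    {φ : Site d → Site d → ℝ} (hφ01 : ∀ ζ x, 0 ≤ φ ζ x ∧ φ ζ x ≤ 1)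
    (hφcore : ∀ ζ x, (∀ i, -(M : ℤ) ≤ 2 * (x i - (M : ℤ) * ζ i) ∧ 2 * (x i - (M : ℤ) * ζ i) ≤ (M : ℤ) - 1) → φ ζ x = 1)
    (hφsupp : ∀ ζ x, 0 < φ ζ x → ∀ i, -(3 * (M : ℤ)) < 4 * (x i - (M : ℤ) * ζ i) ∧ 4 * (x i - (M : ℤ) * ζ i) < 3 * (M : ℤ) - 2)
    (hφlip : ∀ (ζ x : Site d) (μ : Fin d), |φ ζ x - φ ζ (x + e μ)| ≤ 4 / (M : ℝ))
    (hφcov : ∀ ζ w x, φ (ζ + w) (x + (M : ℤ) • w) = φ ζ x)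
    (hZ : ∀ c : Fin d → Fin 2, ∃ Z : Site d → Site d,
      (∀ x, ∃ w : Site d, Z x = (fun i => ((c i : ℕ) : ℤ)) + (2 : ℤ) • w) ∧
      (∀ x i, |x i - (M : ℤ) * Z x i| ≤ (M : ℤ)) ∧
      (∀ (x ζ w : Site d), ζ = (fun i => ((c i : ℕ) : ℤ)) + (2 : ℤ) • w →
        (∀ i, -(M : ℤ) ≤ x i - (M : ℤ) * ζ i ∧ x i - (M : ℤ) * ζ i < (M : ℤ)) → Z x = ζ) ∧
      (∀ (x : Site d) (i : Fin d), Z (x + ((2 * N * M : ℕ) : ℤ) • e i) = Z x + ((2 * N : ℕ) : ℤ) • e i)) :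
    ∃ u : Site d → 𝔸ˣ,
      (∀ x, u x ∈ unitaryUnits 𝔸) ∧ (∀ ζ : Site d, u ((M : ℤ) • ζ) = 1) ∧
      (∀ (x : Site d) (i : Fin d), u (x + ((2 * N * M : ℕ) : ℤ) • e i) = u x) ∧
      (∀ x (ζ : Site d), (∀ i, |x i - (M : ℤ) * ζ i| ≤ (M : ℤ)) →
        ‖((u x : 𝔸ˣ) : 𝔸) - ((g ζ x : 𝔸ˣ) : 𝔸)‖ ≤ (4 ^ (2 ^ d) - 1) / 3 * τcc) ∧
      (∀ (x : Site d) (μ : Fin d), ‖(((Us x μ)⁻¹ * gaugeAct u U' x μ : 𝔸ˣ) : 𝔸) - 1‖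
        ≤ (6 ^ (2 ^ d) - 1) / 5 * (7 * ηch + 16 * ((4 ^ (2 ^ d) - 1) / 3 * τcc) / (M : ℝ))) := by
  classical
  have hM1 : 1 ≤ M := le_trans (by norm_num) hM
  have hM0 : (0 : ℝ) < M := by exact_mod_cast (by omega : 0 < M)
  set K : ℕ := 2 ^ d with hK
  set T : ℕ → ℝ := fun s => (4 ^ s - 1) / 3 * τcc with hT
  set B : ℝ := 7 * ηch + 16 * T K / (M : ℝ) with hB
  set E : ℕ → ℝ := fun s => (6 ^ s - 1) / 5 * B with hE
  have hT0 : ∀ s, 0 ≤ T s := fun s => by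
    simp only [hT]; exact mul_nonneg (div_nonneg (by linarith [one_le_pow₀ (by norm_num : (1 : ℝ) ≤ 4) (n := s)]) (by norm_num)) hτcc0
  have hB0 : 0 ≤ B := by
    simp only [hB]
    exact add_nonneg (by positivity) (div_nonneg (mul_nonneg (by norm_num) (hT0 K)) hM0.le)
  have hE0 : ∀ s, 0 ≤ E s := fun s => by
    simp only [hE]; exact mul_nonneg (div_nonneg (by linarith [one_le_pow₀ (by norm_num : (1 : ℝ) ≤ 6) (n := s)]) (by norm_num)) hB0
  have hcardK : ∀ F : Finset (Fin d → Fin 2), F.card ≤ K := fun F => by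
    have h := Finset.card_le_univ F
    rwa [Fintype.card_fun, Fintype.card_fin, Fintype.card_fin] at h
  -- the parity vector of a colour
  let cv : (Fin d → Fin 2) → Site d := fun c i => ((c i : ℕ) : ℤ)
  -- THE INDUCTION over finite sets of colours
  have key : ∀ F : Finset (Fin d → Fin 2), ∃ u : Site d → 𝔸ˣ,
      (∀ x, u x ∈ unitaryUnits 𝔸) ∧ (∀ ζ : Site d, u ((M : ℤ) • ζ) = 1) ∧
      (∀ (x : Site d) (i : Fin d), u (x + ((2 * N * M : ℕ) : ℤ) • e i) = u x) ∧
      (∀ x, (∃ c' ∈ {p : Site d | ∃ c ∈ F, p = cv c}, ∃ ζ w : Site d, ζ = c' + (2 : ℤ) • w ∧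
          ∀ i, -(M : ℤ) ≤ 2 * (x i - (M : ℤ) * ζ i) ∧ 2 * (x i - (M : ℤ) * ζ i) ≤ (M : ℤ) - 1) →
        ∀ ζ : Site d, (∀ i, |x i - (M : ℤ) * ζ i| ≤ (M : ℤ)) → ‖((u x : 𝔸ˣ) : 𝔸) - ((g ζ x : 𝔸ˣ) : 𝔸)‖ ≤ T F.card) ∧
      (∀ (x : Site d) (μ : Fin d),
        (∃ c' ∈ {p : Site d | ∃ c ∈ F, p = cv c}, ∃ ζ w : Site d, ζ = c' + (2 : ℤ) • w ∧
          ∀ i, -(M : ℤ) ≤ 2 * (x i - (M : ℤ) * ζ i) ∧ 2 * (x i - (M : ℤ) * ζ i) ≤ (M : ℤ) - 1) →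
        (∃ c' ∈ {p : Site d | ∃ c ∈ F, p = cv c}, ∃ ζ w : Site d, ζ = c' + (2 : ℤ) • w ∧
          ∀ i, -(M : ℤ) ≤ 2 * ((x + e μ) i - (M : ℤ) * ζ i) ∧ 2 * ((x + e μ) i - (M : ℤ) * ζ i) ≤ (M : ℤ) - 1) →
        ‖(((Us x μ)⁻¹ * gaugeAct u U' x μ : 𝔸ˣ) : 𝔸) - 1‖ ≤ E F.card) := by
    intro F
    induction F using Finset.induction_on with
    | empty =>
        refine ⟨fun _ => 1, fun _ => (unitaryUnits 𝔸).one_mem, fun _ => rfl, fun _ _ => rfl, ?_, ?_⟩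
        · rintro x ⟨c', hc', -⟩; simp at hc'
        · rintro x μ ⟨c', hc', -⟩; simp at hc'
    | insert c₀ F hc₀ ih =>
        obtain ⟨u, huU, hupin, huper, husite, hubond⟩ := ih
        obtain ⟨Z, hZpar, hZcube, hZuniq, hZper⟩ := hZ c₀
        have hτs : T F.card ≤ 1 / 4 := (tau_mono (hcardK F) hτcc0).trans hsmall
        obtain ⟨u', hu'U, hu'pin, hu'per, hu'site, hu'bond⟩ :=
          colour_step hUs hU' hM hgU hpin hηch herr hgeq hτcc hφ01 hφcore hφsupp hφlip hφcov (cv c₀) hZpar hZcube hZuniq hZper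
            {p : Site d | ∃ c ∈ F, p = cv c} (hT0 F.card) (hE0 F.card) hτs huU hupin huper husite hubond
        -- the covered sets agree
        have hset : {p : Site d | ∃ c ∈ insert c₀ F, p = cv c} = {p : Site d | ∃ c ∈ F, p = cv c} ∪ {cv c₀} := by
          ext p
          simp only [Set.mem_setOf_eq, Set.mem_union, Set.mem_singleton_iff, Finset.mem_insert]
          constructor
          · rintro ⟨c, hc | hc, rfl⟩
            · exact Or.inr (by rw [hc])
            · exact Or.inl ⟨c, hc, rfl⟩
          · rintro (⟨c, hc, rfl⟩ | h)
            · exact ⟨c, Or.inr hc, rfl⟩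
            · exact ⟨c₀, Or.inl rfl, h⟩
        rw [Finset.card_insert_of_notMem hc₀]
        refine ⟨u', hu'U, hu'pin, hu'per, fun x hx ζ hζ => ?_, fun x μ hx hy => ?_⟩
        · rw [hset] at hx
          have h := hu'site x hx ζ hζ
          simp only [hT] at h ⊢
          linarith [tau_step F.card τcc]
        · rw [hset] at hx hy
          have h := hu'bond x μ hx hy
          have hBstep : 7 * ηch + 16 * T F.card / (M : ℝ) ≤ B := by
            have hTm : T F.card ≤ T K := by simp only [hT]; exact tau_mono (hcardK F) hτcc0
            have h16 : 16 * T F.card / (M : ℝ) ≤ 16 * T K / (M : ℝ) := by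
              apply div_le_div_of_nonneg_right _ hM0.le; linarith
            simp only [hB]; linarith
          have hstep := eta_step F.card (B := B) hBstep
          simp only [hE] at h ⊢
          exact h.trans hstep
  -- at the end every site is covered
  obtain ⟨u, huU, hupin, huper, husite, hubond⟩ := key Finset.univ
  have hcov : ∀ x : Site d, ∃ c' ∈ {p : Site d | ∃ c ∈ (Finset.univ : Finset (Fin d → Fin 2)), p = cv c}, ∃ ζ w : Site d,
      ζ = c' + (2 : ℤ) • w ∧ ∀ i, -(M : ℤ) ≤ 2 * (x i - (M : ℤ) * ζ i) ∧ 2 * (x i - (M : ℤ) * ζ i) ≤ (M : ℤ) - 1 := by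
    intro x
    let ζ : Site d := fun i => (2 * x i + M) / (2 * (M : ℤ))
    obtain ⟨c, w, hcw⟩ := exists_parity_decomp ζ
    exact ⟨cv c, ⟨c, Finset.mem_univ c, rfl⟩, ζ, w, hcw, fun i => coreIndex_mem hM1 x i⟩
  have hcardU : (Finset.univ : Finset (Fin d → Fin 2)).card = K := by
    rw [Finset.card_univ, Fintype.card_fun, Fintype.card_fin, Fintype.card_fin]
  refine ⟨u, huU, hupin, huper, fun x ζ hζ => ?_, fun x μ => ?_⟩
  · have h := husite x (hcov x) ζ hζ; rwa [hcardU] at h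
  · have h := hubond x μ (hcov x) (hcov (x + e μ)); rwa [hcardU] at h

end

end Summit.QuantumFields.BalabanUV.T4Continuum.NE7PairColourGlue
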